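import Summits.AtomisticToContinuum.BoseEinsteinCondensation.Theorems.PeriodicIRBound.Negative.FreeGas
import Summits.AtomisticToContinuum.BoseEinsteinCondensation.Theorems.BECConjugateDominationHardCoreExtensionTruncationEnergyConvergenceAll
import Literature.MathematicalPhysics.QuantumManyBody.PeriodicKineticBudget
import Literature.MathematicalPhysics.QuantumManyBody.BoseGasDirichletWall
import HarnessLib

/-!
# Route `BECGroundStateSOS`, crux `PeriodicIRBound` (stmt-AtomisticToContinuum-3972), line
# `hardcore-monotone-class-uniformity` — stub `stub_towerTransfer`: the truncation transfer

The lever of the line: an infrared bound for the BOUNDED truncations `v_M = min(v, M)` of an admissible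
potential `v`, with data `(ρ₀, C)`, `N`-threshold and slack `δ_N` uniform along the tower (for the given
`δ_N`, arbitrarily high levels `M` obey the bound, `∀ M₁ ∃ M ≥ M₁`), transfers to the crux's bound
`IRBoundFor v` for `v` itself — hard cores and non-integrable spikes included.

Mechanism (slack matching at FIXED `(N, L_N)`, `M → ∞` before `N → ∞`): the periodic trial class does not
depend on the potential; `v_M ≤ v` pointwise, so `𝓔_{v_M}[Ψ] ≤ 𝓔_v[Ψ]`; below the Ruelle density
`ρ₁(v)` the periodic ground-state energy `E₀(v; N, L_N)` is finite eventually in `N`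
(`exists_eventually_periodicGroundStateEnergy_lt_top`), and then the landed fixed-volume truncation energy
convergence `stub_truncationEnergyConvergenceAll` gives `E₀(v) ≤ E₀(v_M) + δ₁/2` for all large `M`
(`δ₁ = min δ 1`). Hence every `δ₁/2`-near-minimiser `Ψ` of `v` satisfies
`𝓔_{v_M}[Ψ] ≤ 𝓔_v[Ψ] ≤ E₀(v) + δ₁/2 ≤ E₀(v_M) + δ₁ ≤ E₀(v_M) + δ`, i.e. is a `δ`-near-minimiser of `v_M`
for a level `M` of the tower, and inherits the infrared inequality with the tower's constant. No spectral
information on `v` is used. This is verbatim the slack matching of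
`Cruxes.HardCoreExtension.NearMinTower.nearMinBEC_of_minorantTower` (adapted from
`Theorems/BECConjugateDominationHardCoreExtensionNearMinTower.lean`) with the BEC-floor predicate
replaced by an arbitrary predicate on trial states, instantiated at the infrared inequality on the window.

No new definitions: the statement is the registered stub signature, written over the landed vocabulary
`NearMin / InWindow / IRIneq / IRBoundFor` (`Negative.TwoModeStates`) and `truncPotential`
(`Literature.MathematicalPhysics.QuantumManyBody.BoseGas`).

References: E. H. Lieb, R. Seiringer, J. P. Solovej, J. Yngvason, *The Mathematics of the Bose Gas and its
Condensation* (2005), §1.2 (1.17)–(1.19); D. Ruelle, *Statistical Mechanics* (1969), §3.5.11; M. Reed,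
B. Simon, *Methods of Modern Mathematical Physics IV* (1978), Thm XIII.64.
-/

noncomputable section

open MeasureTheory Filter
open scoped ENNReal NNReal

namespace Summit.AtomisticToContinuum.BoseEinsteinCondensation.Cruxes.PeriodicIRBound.HardcoreMonotoneClassUniformity

open Literature.MathematicalPhysics.QuantumManyBody.BoseGas
open Summit.AtomisticToContinuum.BoseEinsteinCondensation.Theorems.PeriodicIRBound.Negative
  (NearMin InWindow IRIneq IRBoundFor)

/-- **Slack transfer along a tower of minorants, for an arbitrary predicate** (fixed volume). At fixed
`(N, L)`: if `wₙ ≤ v` pointwise, `E₀(v) ≤ E₀(wₙ) + ε` for all large `n` (every `ε > 0`), and ONE slack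
`δ > 0` makes, for arbitrarily large levels `n`, every `δ`-near-minimiser of `wₙ` satisfy `Q`, then every
`δ'`-near-minimiser of `v` satisfies `Q` for some `δ' > 0` (`δ' = min(δ,1)/2`:
`E_{wₙ} Ψ ≤ E_v Ψ ≤ E₀(v) + δ' ≤ E₀(wₙ) + 2δ'`). Predicate-agnostic form of
`NearMinTower.nearMinBEC_of_minorantTower`. [cite: LSSY2005, §1.2 (1.17)–(1.19)] -/
private theorem nearMin_transfer_of_minorantTower {N : ℕ} {L : ℝ} (v : ℝ → ℝ≥0∞)
    (w : ℕ → ℝ → ℝ≥0∞) (Q : PeriodicTrialState N L → Prop)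
    (hwv : ∀ n r, w n r ≤ v r)
    (hconv : ∀ ε : ℝ, 0 < ε → ∃ n₁ : ℕ, ∀ n : ℕ, n₁ ≤ n →
      periodicGroundStateEnergy v N L ≤ periodicGroundStateEnergy (w n) N L + ENNReal.ofReal ε)
    {δ : ℝ≥0∞} (hδ : 0 < δ)
    (h : ∀ n₁ : ℕ, ∃ n : ℕ, n₁ ≤ n ∧ ∀ Ψ : PeriodicTrialState N L,
      periodicEnergy (w n) Ψ ≤ periodicGroundStateEnergy (w n) N L + δ → Q Ψ) :
    ∃ δ' : ℝ≥0∞, 0 < δ' ∧ ∀ Ψ : PeriodicTrialState N L,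
      periodicEnergy v Ψ ≤ periodicGroundStateEnergy v N L + δ' → Q Ψ := by
  -- adapted from `Cruxes.HardCoreExtension.NearMinTower.nearMinBEC_of_minorantTower`
  -- a finite positive slack below `δ`
  set δ₁ : ℝ≥0∞ := min δ 1 with hδ₁
  have hδ₁pos : 0 < δ₁ := lt_min hδ one_pos
  have hδ₁top : δ₁ ≠ ⊤ := ne_top_of_le_ne_top ENNReal.one_ne_top (min_le_right _ _)
  have hδ₁le : δ₁ ≤ δ := min_le_left _ _
  have hhalf_ne : δ₁ / 2 ≠ 0 := (ENNReal.half_pos hδ₁pos.ne').ne'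
  have hhalf_top : δ₁ / 2 ≠ ⊤ := ENNReal.div_ne_top hδ₁top two_ne_zero
  set ε : ℝ := (δ₁ / 2).toReal with hε
  have hεpos : 0 < ε := ENNReal.toReal_pos hhalf_ne hhalf_top
  have hεeq : ENNReal.ofReal ε = δ₁ / 2 := ENNReal.ofReal_toReal hhalf_top
  obtain ⟨n₁, hn₁⟩ := hconv ε hεpos
  obtain ⟨n, hn, hQ⟩ := h n₁
  refine ⟨δ₁ / 2, ENNReal.half_pos hδ₁pos.ne', fun Ψ hΨ => hQ Ψ ?_⟩
  calc periodicEnergy (w n) Ψ ≤ periodicEnergy v Ψ := periodicEnergy_mono_of_le (hwv n) Ψ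
    _ ≤ periodicGroundStateEnergy v N L + δ₁ / 2 := hΨ
    _ ≤ periodicGroundStateEnergy (w n) N L + ENNReal.ofReal ε + δ₁ / 2 := by gcongr; exact hn₁ n hn
    _ = periodicGroundStateEnergy (w n) N L + δ₁ := by rw [hεeq, add_assoc, ENNReal.add_halves]
    _ ≤ periodicGroundStateEnergy (w n) N L + δ := by gcongr

/-- **stub_towerTransfer — the truncation transfer** (registered stub of line
`hardcore-monotone-class-uniformity`, `TruncationTransfer` unfolded): a tower-uniform infrared bound for
the bounded truncations `min(v, M)` of an admissible `v` (data `(ρ₀, C)`, `N`-threshold and slack uniform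
along the tower, `∀ M₁ ∃ M ≥ M₁`) implies `IRBoundFor v`. Fix `κ`; take `(ρ₀, C)` from the tower bound and
`ρ₁(v)` from Ruelle finiteness; for `ρ < min ρ₀ ρ₁`, eventually in `N`: `E₀(v; N, L_N) < ⊤`, `0 < L_N`, and
a tower slack `δ`; the fixed-volume truncation energy convergence and the slack matching
`𝓔_{v_M}[Ψ] ≤ 𝓔_v[Ψ] ≤ E₀(v) + δ₁/2 ≤ E₀(v_M) + δ₁ ≤ E₀(v_M) + δ` make every `δ₁/2`-near-minimiser of `v`
a `δ`-near-minimiser of a tower level `v_M`, which inherits the inequality on the window.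
[cite: LSSY2005, §1.2 (1.17)–(1.19)] -/
theorem stub_towerTransfer :
    ∀ v : ℝ → ℝ≥0∞, IsRepulsiveFiniteRange v →
      (∀ κ : ℝ, 0 < κ → ∃ ρ₀ : ℝ, 0 < ρ₀ ∧ ∃ C : ℝ, 0 < C ∧ ∀ ρ : ℝ, 0 < ρ → ρ < ρ₀ →
        ∀ᶠ N : ℕ in atTop, ∃ δ : ℝ≥0∞, 0 < δ ∧ ∀ M₁ : ℕ, ∃ M : ℕ, M₁ ≤ M ∧
          ∀ Ψ : PeriodicTrialState N (sideLength ρ N), NearMin (truncPotential v M) ρ N δ Ψ →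
            ∀ k : Fin 3 → ℤ, InWindow κ ρ N k → IRIneq C ρ N Ψ.ψ k) →
      IRBoundFor v := by
  intro v hv hT κ hκ
  obtain ⟨ρ₀, hρ₀, C, hC, hW⟩ := hT κ hκ
  obtain ⟨ρF, hρF, hfin⟩ :=
    Literature.Barriers.AtomisticToContinuum.BoseGas.exists_eventually_periodicGroundStateEnergy_lt_top hv
  refine ⟨min ρ₀ ρF, lt_min hρ₀ hρF, C, hC, fun ρ hρ hρlt => ?_⟩
  filter_upwards [hW ρ hρ (hρlt.trans_le (min_le_left _ _)),
    hfin ρ hρ (hρlt.trans_le (min_le_right _ _)), eventually_gt_atTop 0] with N hN₁ hEfin hNpos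
  obtain ⟨δ, hδ, htower⟩ := hN₁
  have hL : 0 < sideLength ρ N := sideLength_pos_of_pos hρ hNpos
  -- the slack matching along the truncation tower `min(v, M) ≤ v`, predicate = the IR inequality on the window
  obtain ⟨δ', hδ', h'⟩ := nearMin_transfer_of_minorantTower v (fun M => truncPotential v M)
    (fun Ψ : PeriodicTrialState N (sideLength ρ N) =>
      ∀ k : Fin 3 → ℤ, InWindow κ ρ N k → IRIneq C ρ N Ψ.ψ k)
    (fun _ _ => min_le_left _ _)
    (fun ε hε =>
      Summit.AtomisticToContinuum.BoseEinsteinCondensation.Cruxes.HardCoreExtension.ThirdLawCurrentFloorAlt.stub_truncationEnergyConvergenceAll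
        v hv N _ hL hEfin.ne ε hε)
    hδ htower
  exact ⟨δ', hδ', h'⟩

end Summit.AtomisticToContinuum.BoseEinsteinCondensation.Cruxes.PeriodicIRBound.HardcoreMonotoneClassUniformity

end
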